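import Mathlib.Analysis.InnerProductSpace.l2Space
import Mathlib.MeasureTheory.Function.StronglyMeasurable.AEStronglyMeasurable
import HarnessLib

/-!
# Pettis' measurability theorem in a separable Hilbert space

A map `g : X → H` into a separable Hilbert space whose scalar pairings `x ↦ ⟪w, g x⟫` are
(a.e.-strongly) measurable for every `w ∈ H` is (a.e.-)strongly measurable
(`stronglyMeasurable_of_inner`, `aestronglyMeasurable_of_inner`). This is the Hilbert-space case
of Pettis' measurability theorem (Pettis 1938, Thm. 1.1: weakly measurable and almost separably
valued ⇒ strongly measurable); in a separable Hilbert space the proof is elementary — expand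
`g x = ∑ᵢ ⟪bᵢ, g x⟫ bᵢ` in a Hilbert basis `(bᵢ)`, which is countable by separability
(`countable_of_orthonormal`), so that `g` is a pointwise limit along the countably generated
filter of finite partial sums of measurable maps.

Typical use: a weakly continuous trajectory `u : [0, T] → H` of an evolution equation (e.g. a
Leray–Hopf solution, weakly continuous into `L²`) is strongly measurable, so `t ↦ Ψ(u(t))` is
measurable for every Borel `Ψ : H → ℝ`.

## Mathlib search

Mathlib (this pin) has `HilbertBasis`, `exists_hilbertBasis`, `HilbertBasis.hasSum_repr`,
`stronglyMeasurable_of_tendsto`, `aestronglyMeasurable_of_tendsto_ae`,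
`Pairwise.countable_of_isOpen_disjoint`; it has no Pettis theorem and no statement deriving
(strong) measurability from measurability of inner products (searched `Pettis`,
`weakly measurable`, `of_inner`: nothing).

## References

* B. J. Pettis, *On integration in vector spaces*, Trans. Amer. Math. Soc. 44 (1938) 277–304,
  Thm. 1.1. [Pettis1938]
-/

noncomputable section

open MeasureTheory Filter Topology
open scoped InnerProductSpace

namespace Literature.MeasureTheory.VectorMeasurability

variable {𝕜 : Type*} [RCLike 𝕜]
variable {H : Type*} [NormedAddCommGroup H] [InnerProductSpace 𝕜 H]

/-- An orthonormal family in a separable inner product space is countable: distinct members are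
at distance `√2 > 1`, so the open balls of radius `1/2` around them are pairwise disjoint, and a
separable space has only countably many pairwise disjoint nonempty open sets. [folklore] -/
theorem countable_of_orthonormal [TopologicalSpace.SeparableSpace H] {ι : Type*} {v : ι → H}
    (hv : Orthonormal 𝕜 v) : Countable ι := by
  refine Pairwise.countable_of_isOpen_disjoint (s := fun i => Metric.ball (v i) (1 / 2))
    (fun i j hij => ?_) (fun i => Metric.isOpen_ball) fun i => ⟨v i, Metric.mem_ball_self one_half_pos⟩
  refine Set.disjoint_left.2 fun x hxi hxj => ?_
  rw [Metric.mem_ball] at hxi hxj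
  have hdist : ‖v i - v j‖ ^ 2 = 2 := by
    have h := @norm_sub_sq 𝕜 _ _ _ _ (v i) (v j)
    rw [hv.1 i, hv.1 j, hv.2 hij, map_zero] at h
    rw [h]
    norm_num
  have hlt : ‖v i - v j‖ < 1 :=
    calc ‖v i - v j‖ = dist (v i) (v j) := (dist_eq_norm _ _).symm
      _ ≤ dist x (v i) + dist x (v j) := dist_triangle_left _ _ _
      _ < 1 / 2 + 1 / 2 := add_lt_add hxi hxj
      _ = 1 := by norm_num
  nlinarith [norm_nonneg (v i - v j)]

variable [CompleteSpace H] [TopologicalSpace.SeparableSpace H] {X : Type*} [MeasurableSpace X]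

/-- **Pettis' measurability theorem, separable Hilbert space** (Pettis 1938, Thm. 1.1): if
`x ↦ ⟪w, g x⟫` is strongly measurable for every `w ∈ H`, then `g : X → H` is strongly measurable.
Proof: `g x = ∑ᵢ ⟪bᵢ, g x⟫ bᵢ` along a (countable) Hilbert basis, a pointwise limit over the
countably generated filter of finite sets of measurable partial sums. [cite: Pettis1938, Thm. 1.1] -/
theorem stronglyMeasurable_of_inner {g : X → H}
    (hg : ∀ w : H, StronglyMeasurable fun x => ⟪w, g x⟫_𝕜) : StronglyMeasurable g := by
  obtain ⟨s, b, hb⟩ := exists_hilbertBasis 𝕜 H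
  haveI : Countable s := countable_of_orthonormal b.orthonormal
  have hsum : ∀ x, HasSum (fun i : s => ⟪(b i : H), g x⟫_𝕜 • (b i : H)) (g x) := fun x => by
    simpa only [HilbertBasis.repr_apply_apply] using b.hasSum_repr (g x)
  refine stronglyMeasurable_of_tendsto (atTop : Filter (Finset s))
    (f := fun t x => ∑ i ∈ t, ⟪(b i : H), g x⟫_𝕜 • (b i : H)) (fun t => ?_)
    (tendsto_pi_nhds.2 fun x => hsum x)
  exact Finset.stronglyMeasurable_fun_sum t fun i _ => (hg (b i)).smul_const (b i : H)

/-- **Pettis' measurability theorem, a.e. form** (Pettis 1938, Thm. 1.1): if `x ↦ ⟪w, g x⟫` is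
a.e.-strongly measurable for every `w ∈ H` (`H` a separable Hilbert space), then `g : X → H` is
a.e.-strongly measurable. Only the countably many pairings with a Hilbert basis are used. [cite: Pettis1938, Thm. 1.1] -/
theorem aestronglyMeasurable_of_inner {μ : Measure X} {g : X → H}
    (hg : ∀ w : H, AEStronglyMeasurable (fun x => ⟪w, g x⟫_𝕜) μ) : AEStronglyMeasurable g μ := by
  obtain ⟨s, b, hb⟩ := exists_hilbertBasis 𝕜 H
  haveI : Countable s := countable_of_orthonormal b.orthonormal
  have hsum : ∀ x, HasSum (fun i : s => ⟪(b i : H), g x⟫_𝕜 • (b i : H)) (g x) := fun x => by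
    simpa only [HilbertBasis.repr_apply_apply] using b.hasSum_repr (g x)
  refine aestronglyMeasurable_of_tendsto_ae (atTop : Filter (Finset s))
    (f := fun t x => ∑ i ∈ t, ⟪(b i : H), g x⟫_𝕜 • (b i : H)) (fun t => ?_)
    (ae_of_all _ fun x => hsum x)
  exact Finset.aestronglyMeasurable_fun_sum t fun i _ => (hg (b i)).smul_const (b i : H)

end Literature.MeasureTheory.VectorMeasurability
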